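import Mathlib.Analysis.Matrix.PosDef
import Mathlib.Analysis.Matrix.Spectrum
import Literature.Analysis.ValidatedNumerics.BoxCover
import Literature.Analysis.ValidatedNumerics.SymmetricEigenCertificate
import Literature.LinearAlgebra.Matrix.HermitianEigenvaluePerturbation
import HarnessLib

/-!
# Eigenvalue enclosures of symmetric / Hermitian matrices from kernel-checked certificates

Topic `Literature/Analysis/ValidatedNumerics`. The MATRIX layer of the generic eigen-enclosure
infrastructure (`KernelData` → `QuadFormEnclosure` → `SymmetricEigenCertificate` → this file):
the checkers `checkLower`, `checkLowerHerm`, `checkUpper`, `checkUpperHerm` of literal rational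
data are turned into statements about Mathlib matrices `A : Matrix (Fin n) (Fin n) ℝ` and
`H : Matrix (Fin n) (Fin n) ℂ` lying entrywise in the certified interval family, and about the
eigenvalues `Matrix.IsHermitian.eigenvalues` of the symmetric / Hermitian ones:

* `le_eigenvalues_of_checkLower`, `le_eigenvalues_of_checkLowerHerm` — `lam ≤ λᵢ` for ALL `i`
  (a certified lower bound of the spectrum of every symmetric/Hermitian matrix of the family);
* `posDef_of_checkLower`, `posDef_of_checkLowerHerm` — positive definiteness when `lam > 0`;
* `mul_dotProduct_le_of_checkLower`, `mul_normSq_le_re_of_checkLowerHerm` — the form bounds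
  `lam · ‖v‖² ≤ re (v* A v)` themselves (no symmetry needed);
* `exists_eigenvalues_le_of_checkUpper`, `exists_eigenvalues_le_of_checkUpperHerm` — `λᵢ ≤ μ`
  for SOME `i` (a certified upper bound of the least eigenvalue), from a rational test vector;
* PARAMETRIC FAMILIES over a rational box (`BoxCover.lean`): `SymLeaf`/`HermLeaf` (per-box
  enclosure data + certificate + auxiliary data for a user-supplied entry-enclosure check),
  `symLeafOK`/`hermLeafOK`, and `le_eigenvalues_on_box_of_kdCheck(_real)`: a kd-tree of such
  leaves accepted by `KdCert.check` proves `lam ≤ λᵢ(H k)` for EVERY parameter `k` of the box —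
  the shape of a certified "Bloch scan" (a Hermitian symbol over a torus of quasi-momenta) or of a
  stiffness/Gram family over a window of moduli.

Generic spectral lemmas proved on the way (any `RCLike` field, any finite index type):
`le_eigenvalues_of_forall_re_form` (a uniform lower form bound bounds every eigenvalue),
`re_star_dotProduct_mulVec_eq_sum` (`re (v* A v) = Σᵢ λᵢ |⟪uᵢ, v⟫|²`),
`mul_normSq_le_re_form_of_le_eigenvalues` (the converse direction: `λᵢ ≥ lam ∀ i ⇒ form ≥ lam‖v‖²`),
`exists_eigenvalues_le_of_re_form_le` (Rayleigh: some eigenvalue is below any Rayleigh quotient).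

## How a consumer uses it

A compute job encloses the entries of its matrix (e.g. a Bloch symbol at a `k`-box, a Gram or
stiffness matrix with interval data) by rationals `Cre ± Δ` (`+ i·Cim`), factors
`C − (lam + ρ) I ≈ L·diag(D)·Lᵀ` in floating point with `ρ ≥ max_i radRow Δ i`, rounds `L`, `D`,
`lam` to a dyadic grid, and prints the Lean term
`theorem foo_check : checkLowerHerm n Cre Cim Δ ⟨lam, k, L, D⟩ = true := by decide +kernel`
(or `native_decide`); `le_eigenvalues_of_checkLowerHerm foo_check hH hΔ i` is then the enclosure
`lam ≤ λᵢ(H)` for every Hermitian `H` of the family. For a concrete matrix the entry hypothesis is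
discharged by `fin_cases`, e.g. (validated pattern, `A = !![1, 1; 1, 6/5]`, `hA : A.IsHermitian`,
`chk : checkLower 2 [[1,1],[1,6/5]] [[0,0],[0,0]] ⟨9/100, 1, [[1],[100/91]], [91/100]⟩ = true := by decide +kernel`):
`simpa using le_eigenvalues_of_checkLower chk hA (fun i j ↦ by fin_cases i <;> fin_cases j <;> simp [A, mreal, mget]) i`
proves `(9/100 : ℝ) ≤ hA.eigenvalues i`, and `posDef_of_checkLower chk (by norm_num) hA hΔ : A.PosDef`.
Everything here is proved; no named facts.

## References

* S. M. Rump, *Verification methods: rigorous results using floating-point arithmetic*, Acta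
  Numerica 19 (2010), §10.8. [folklore]
* R. A. Horn, C. R. Johnson, *Matrix Analysis* (2nd ed., 2013), Thm. 4.2.2 (Rayleigh quotient
  bounds `λ_min ≤ x*Ax/x*x ≤ λ_max`). [folklore]
-/

noncomputable section

open Finset Matrix WithLp
open scoped InnerProductSpace

namespace Literature.Analysis.ValidatedNumerics

/-! ### Generic spectral lemmas -/

section Spectral

variable {𝕜 : Type*} [RCLike 𝕜] {m : Type*} [Fintype m] [DecidableEq m] {A : Matrix m m 𝕜}

/-- **A uniform lower bound of the form bounds every eigenvalue**: if
`lam · Σ ‖v i‖² ≤ re (v* A v)` for all `v` then `lam ≤ λᵢ` for every eigenvalue of the Hermitian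
matrix `A` (evaluate at a unit eigenvector). [folklore] -/
theorem le_eigenvalues_of_forall_re_form (hA : A.IsHermitian) {lam : ℝ}
    (h : ∀ v : m → 𝕜, lam * ∑ i, ‖v i‖ ^ 2 ≤ RCLike.re (star v ⬝ᵥ (A *ᵥ v))) (i : m) :
    lam ≤ hA.eigenvalues i := by
  have h1 := h ⇑(hA.eigenvectorBasis i)
  have h2 : ∑ j, ‖(hA.eigenvectorBasis i) j‖ ^ 2 = 1 := by
    rw [← EuclideanSpace.norm_sq_eq, hA.eigenvectorBasis.orthonormal.1 i, one_pow]
  rw [h2, mul_one, ← hA.eigenvalues_eq i] at h1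
  exact h1

/-- **Spectral expansion of the form**: `re (v* A v) = Σᵢ λᵢ · ‖⟪uᵢ, v⟫‖²` in an orthonormal
eigenbasis `uᵢ` of the Hermitian matrix `A`. [folklore] -/
theorem re_star_dotProduct_mulVec_eq_sum (hA : A.IsHermitian) (v : m → 𝕜) :
    RCLike.re (star v ⬝ᵥ (A *ᵥ v)) =
      ∑ i, hA.eigenvalues i * ‖⟪hA.eigenvectorBasis i, toLp 2 v⟫_𝕜‖ ^ 2 := by
  set b := hA.eigenvectorBasis with hb
  set x : EuclideanSpace 𝕜 m := toLp 2 v with hx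
  have hsym : (toEuclideanLin A).IsSymmetric := isSymmetric_toEuclideanLin_iff.mpr hA
  have hinner : star v ⬝ᵥ (A *ᵥ v) = ⟪x, toEuclideanLin A x⟫_𝕜 := by
    rw [dotProduct_comm]; rfl
  have hcoef : ∀ k, ⟪b k, toEuclideanLin A x⟫_𝕜 = ((hA.eigenvalues k : ℝ) : 𝕜) * ⟪b k, x⟫_𝕜 := by
    intro k
    rw [← hsym (b k) x, hb, Literature.LinearAlgebra.Matrix.toEuclideanLin_eigenvectorBasis hA k,
      inner_smul_left, RCLike.conj_ofReal]
  rw [hinner, ← b.sum_inner_mul_inner x (toEuclideanLin A x), map_sum]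
  refine Finset.sum_congr rfl fun k _ ↦ ?_
  rw [hcoef k, ← inner_conj_symm x (b k)]
  have e : (starRingEnd 𝕜) ⟪b k, x⟫_𝕜 * (((hA.eigenvalues k : ℝ) : 𝕜) * ⟪b k, x⟫_𝕜) =
      ((hA.eigenvalues k * ‖⟪b k, x⟫_𝕜‖ ^ 2 : ℝ) : 𝕜) := by
    rw [mul_left_comm, RCLike.conj_mul]
    push_cast
    ring
  rw [e, RCLike.ofReal_re]

/-- **Eigenvalue lower bounds give form lower bounds**: if `lam ≤ λᵢ` for all `i` then
`lam · Σ ‖v i‖² ≤ re (v* A v)` for every `v`. [folklore] -/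
theorem mul_normSq_le_re_form_of_le_eigenvalues (hA : A.IsHermitian) {lam : ℝ}
    (h : ∀ i, lam ≤ hA.eigenvalues i) (v : m → 𝕜) :
    lam * ∑ i, ‖v i‖ ^ 2 ≤ RCLike.re (star v ⬝ᵥ (A *ᵥ v)) := by
  rw [re_star_dotProduct_mulVec_eq_sum hA v]
  have hx : ∑ i, ‖v i‖ ^ 2 = ∑ i, ‖⟪hA.eigenvectorBasis i, toLp 2 v⟫_𝕜‖ ^ 2 := by
    rw [hA.eigenvectorBasis.sum_sq_norm_inner_right, EuclideanSpace.norm_sq_eq]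
  rw [hx, Finset.mul_sum]
  exact Finset.sum_le_sum fun i _ ↦ mul_le_mul_of_nonneg_right (h i) (sq_nonneg _)

/-- **Rayleigh bound**: if a vector `v` with `Σ ‖v i‖² > 0` has `re (v* A v) ≤ μ · Σ ‖v i‖²` then
some eigenvalue of the Hermitian matrix `A` is `≤ μ`. [folklore] -/
theorem exists_eigenvalues_le_of_re_form_le (hA : A.IsHermitian) {μ : ℝ} {v : m → 𝕜}
    (hv : 0 < ∑ i, ‖v i‖ ^ 2) (h : RCLike.re (star v ⬝ᵥ (A *ᵥ v)) ≤ μ * ∑ i, ‖v i‖ ^ 2) :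
    ∃ i, hA.eigenvalues i ≤ μ := by
  rcases isEmpty_or_nonempty m with hm | hm
  · simp at hv
  by_contra hne
  simp only [not_exists, not_le] at hne
  obtain ⟨i₀, -, hi₀⟩ := Finset.exists_min_image Finset.univ hA.eigenvalues Finset.univ_nonempty
  have h1 := mul_normSq_le_re_form_of_le_eigenvalues hA (fun i ↦ hi₀ i (Finset.mem_univ _)) v
  have h2 := mul_lt_mul_of_pos_right (hne i₀) hv
  linarith

end Spectral

/-! ### Padding `Fin n`-indexed data to `ℕ`-indexed data -/

section Pad

variable {R : Type*} [Zero R] {n : ℕ}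

/-- An `n × n` matrix read as an `ℕ`-indexed table (`0` outside the block). [folklore] -/
def padM (A : Matrix (Fin n) (Fin n) R) (i j : ℕ) : R :=
  if h : i < n ∧ j < n then A ⟨i, h.1⟩ ⟨j, h.2⟩ else 0

/-- A vector on `Fin n` read as an `ℕ`-indexed sequence (`0` beyond `n`). [folklore] -/
def padV (v : Fin n → R) (i : ℕ) : R := if h : i < n then v ⟨i, h⟩ else 0

/-- `padM` on the block. [folklore] -/
@[simp] theorem padM_val (A : Matrix (Fin n) (Fin n) R) (i j : Fin n) : padM A i j = A i j := by
  simp [padM, i.isLt, j.isLt]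

/-- `padV` on the block. [folklore] -/
@[simp] theorem padV_val (v : Fin n → R) (i : Fin n) : padV v i = v i := by
  simp [padV, i.isLt]

/-- `padM` at indices below `n`. [folklore] -/
theorem padM_of_lt (A : Matrix (Fin n) (Fin n) R) {i j : ℕ} (hi : i < n) (hj : j < n) :
    padM A i j = A ⟨i, hi⟩ ⟨j, hj⟩ := by
  simp [padM, hi, hj]

/-- `padV` at indices below `n`. [folklore] -/
theorem padV_of_lt (v : Fin n → R) {i : ℕ} (hi : i < n) : padV v i = v ⟨i, hi⟩ := by
  simp [padV, hi]

end Pad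

variable {n : ℕ}

/-- The Hermitian form of a matrix is the `ℕ`-indexed form of its padding. [folklore] -/
theorem hermForm_pad {𝕜 : Type*} [RCLike 𝕜] (A : Matrix (Fin n) (Fin n) 𝕜) (v : Fin n → 𝕜) :
    ∑ i ∈ range n, ∑ j ∈ range n, star (padV v i) * padM A i j * padV v j = star v ⬝ᵥ (A *ᵥ v) := by
  simp only [dotProduct, Matrix.mulVec, Finset.mul_sum, Pi.star_apply]
  rw [← Fin.sum_univ_eq_sum_range]
  refine Finset.sum_congr rfl fun i _ ↦ ?_
  rw [← Fin.sum_univ_eq_sum_range]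
  refine Finset.sum_congr rfl fun j _ ↦ ?_
  rw [padM_val, padV_val, padV_val, mul_assoc]

/-- `Σ_{i<n} ‖padV v i‖² = Σᵢ ‖v i‖²`. [folklore] -/
theorem normSq_pad {𝕜 : Type*} [RCLike 𝕜] (v : Fin n → 𝕜) :
    ∑ i ∈ range n, ‖padV v i‖ ^ 2 = ∑ i, ‖v i‖ ^ 2 := by
  rw [← Fin.sum_univ_eq_sum_range]
  exact Finset.sum_congr rfl fun i _ ↦ by rw [padV_val]

/-- The real quadratic form of a matrix is `quadForm` of its padding. [folklore] -/
theorem quadForm_pad (A : Matrix (Fin n) (Fin n) ℝ) (v : Fin n → ℝ) :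
    quadForm n (padM A) (padV v) = v ⬝ᵥ (A *ᵥ v) := by
  unfold quadForm
  simp only [dotProduct, Matrix.mulVec, Finset.mul_sum]
  rw [← Fin.sum_univ_eq_sum_range]
  refine Finset.sum_congr rfl fun i _ ↦ ?_
  rw [← Fin.sum_univ_eq_sum_range]
  refine Finset.sum_congr rfl fun j _ ↦ ?_
  rw [padM_val, padV_val, padV_val]
  ring

/-- `sqSum` of a padding is the dot square. [folklore] -/
theorem sqSum_pad (v : Fin n → ℝ) : sqSum n (padV v) = v ⬝ᵥ v := by
  unfold sqSum
  simp only [dotProduct]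
  rw [← Fin.sum_univ_eq_sum_range]
  exact Finset.sum_congr rfl fun i _ ↦ by rw [padV_val, sq]

/-! ### Real symmetric interval families -/

/-- **Form bound from a lower certificate (real case)**: if `checkLower n C Δ c = true` then
`lam · (v ⬝ᵥ v) ≤ v ⬝ᵥ A v` for every real matrix `A` with `|A i j − C i j| ≤ Δ i j` and every `v`.
[folklore] -/
theorem mul_dotProduct_le_of_checkLower {C Δ : List (List ℚ)} {c : LDLCert}
    (h : checkLower n C Δ c = true) {A : Matrix (Fin n) (Fin n) ℝ}
    (hΔ : ∀ i j : Fin n, |A i j - mreal C i j| ≤ mreal Δ i j) (v : Fin n → ℝ) :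
    (c.lam : ℝ) * (v ⬝ᵥ v) ≤ v ⬝ᵥ (A *ᵥ v) := by
  rw [← quadForm_pad, ← sqSum_pad]
  refine mul_sqSum_le_quadForm_of_checkLower h (fun i hi j hj ↦ ?_) _
  rw [padM_of_lt A (mem_range.1 hi) (mem_range.1 hj)]
  exact hΔ _ _

/-- **Eigenvalue lower enclosure (real symmetric case)**: if `checkLower n C Δ c = true` then every
eigenvalue of every symmetric `A` with `|A i j − C i j| ≤ Δ i j` is `≥ lam`. [folklore] -/
theorem le_eigenvalues_of_checkLower {C Δ : List (List ℚ)} {c : LDLCert}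
    (h : checkLower n C Δ c = true) {A : Matrix (Fin n) (Fin n) ℝ} (hA : A.IsHermitian)
    (hΔ : ∀ i j : Fin n, |A i j - mreal C i j| ≤ mreal Δ i j) (i : Fin n) :
    (c.lam : ℝ) ≤ hA.eigenvalues i := by
  refine le_eigenvalues_of_forall_re_form hA (fun v ↦ ?_) i
  have h1 := mul_dotProduct_le_of_checkLower h hΔ v
  have e1 : ∑ i, ‖v i‖ ^ 2 = v ⬝ᵥ v := by
    simp only [Real.norm_eq_abs, sq_abs]
    simp only [dotProduct, sq]
  rw [e1, star_trivial, RCLike.re_to_real]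
  exact h1

/-- **Positive definiteness of an interval family (real case)**: a passing lower certificate with
`lam > 0` makes every symmetric matrix of the family positive definite. [folklore] -/
theorem posDef_of_checkLower {C Δ : List (List ℚ)} {c : LDLCert} (h : checkLower n C Δ c = true)
    (hlam : 0 < c.lam) {A : Matrix (Fin n) (Fin n) ℝ} (hA : A.IsHermitian)
    (hΔ : ∀ i j : Fin n, |A i j - mreal C i j| ≤ mreal Δ i j) : A.PosDef :=
  hA.posDef_iff_eigenvalues_pos.2 fun i ↦
    lt_of_lt_of_le (by exact_mod_cast hlam) (le_eigenvalues_of_checkLower h hA hΔ i)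

/-- **Upper enclosure of the least eigenvalue (real symmetric case)**: if `checkUpper n C Δ u μ`
passes then every symmetric `A` of the family has an eigenvalue `≤ μ`. [folklore] -/
theorem exists_eigenvalues_le_of_checkUpper {C Δ : List (List ℚ)} {u : List ℚ} {μ : ℚ}
    (h : checkUpper n C Δ u μ = true) {A : Matrix (Fin n) (Fin n) ℝ} (hA : A.IsHermitian)
    (hΔ : ∀ i j : Fin n, |A i j - mreal C i j| ≤ mreal Δ i j) : ∃ i, hA.eigenvalues i ≤ μ := by
  set v : Fin n → ℝ := fun i ↦ vreal u i with hv
  have hpadV : ∀ i < n, padV v i = vreal u i := fun i hi ↦ by rw [padV_of_lt v hi]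
  have hpadM : ∀ i ∈ range n, ∀ j ∈ range n, |padM A i j - mreal C i j| ≤ mreal Δ i j := by
    intro i hi j hj
    rw [padM_of_lt A (mem_range.1 hi) (mem_range.1 hj)]
    exact hΔ _ _
  obtain ⟨h0, h1⟩ := quadForm_le_mul_sqSum_of_checkUpper h hpadM
  rw [← sqSum_congr hpadV, sqSum_pad] at h0 h1
  rw [← quadForm_congr (fun i _ j _ ↦ rfl) hpadV, quadForm_pad] at h1
  have e1 : ∑ i, ‖v i‖ ^ 2 = v ⬝ᵥ v := by
    simp only [Real.norm_eq_abs, sq_abs]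
    simp only [dotProduct, sq]
  refine exists_eigenvalues_le_of_re_form_le hA (v := v) ?_ ?_
  · rwa [e1]
  · rwa [e1, star_trivial, RCLike.re_to_real]

/-! ### Complex Hermitian interval families -/

/-- **Form bound from a lower certificate (complex case)**: if `checkLowerHerm n Cre Cim Δ c = true`
then `lam · Σ ‖v i‖² ≤ re (v* H v)` for every complex matrix `H` with
`‖H i j − (Cre i j + Cim i j · I)‖ ≤ Δ i j` and every `v`. [folklore] -/
theorem mul_normSq_le_re_of_checkLowerHerm {Cre Cim Δ : List (List ℚ)} {c : LDLCert}
    (h : checkLowerHerm n Cre Cim Δ c = true) {H : Matrix (Fin n) (Fin n) ℂ}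
    (hΔ : ∀ i j : Fin n, ‖H i j - centreC Cre Cim i j‖ ≤ mreal Δ i j) (v : Fin n → ℂ) :
    (c.lam : ℝ) * ∑ i, ‖v i‖ ^ 2 ≤ RCLike.re (star v ⬝ᵥ (H *ᵥ v)) := by
  rw [← hermForm_pad, ← normSq_pad]
  refine mul_normSq_le_re_hermForm_of_checkLowerHerm h (fun i hi j hj ↦ ?_) _
  rw [padM_of_lt H (mem_range.1 hi) (mem_range.1 hj)]
  exact hΔ _ _

/-- **Eigenvalue lower enclosure (complex Hermitian case)**: if `checkLowerHerm n Cre Cim Δ c = true`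
then every eigenvalue of every Hermitian `H` with `‖H i j − (Cre i j + Cim i j · I)‖ ≤ Δ i j` is
`≥ lam`. [folklore] -/
theorem le_eigenvalues_of_checkLowerHerm {Cre Cim Δ : List (List ℚ)} {c : LDLCert}
    (h : checkLowerHerm n Cre Cim Δ c = true) {H : Matrix (Fin n) (Fin n) ℂ} (hH : H.IsHermitian)
    (hΔ : ∀ i j : Fin n, ‖H i j - centreC Cre Cim i j‖ ≤ mreal Δ i j) (i : Fin n) :
    (c.lam : ℝ) ≤ hH.eigenvalues i :=
  le_eigenvalues_of_forall_re_form hH (fun v ↦ mul_normSq_le_re_of_checkLowerHerm h hΔ v) i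

open scoped ComplexOrder in
/-- **Positive definiteness of an interval family (complex case)** (for the `ComplexOrder` on `ℂ`,
as in Mathlib's `Matrix.PosDef`). [folklore] -/
theorem posDef_of_checkLowerHerm {Cre Cim Δ : List (List ℚ)} {c : LDLCert}
    (h : checkLowerHerm n Cre Cim Δ c = true) (hlam : 0 < c.lam) {H : Matrix (Fin n) (Fin n) ℂ}
    (hH : H.IsHermitian) (hΔ : ∀ i j : Fin n, ‖H i j - centreC Cre Cim i j‖ ≤ mreal Δ i j) :
    H.PosDef :=
  hH.posDef_iff_eigenvalues_pos.2 fun i ↦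
    lt_of_lt_of_le (by exact_mod_cast hlam) (le_eigenvalues_of_checkLowerHerm h hH hΔ i)

/-- **Upper enclosure of the least eigenvalue (complex Hermitian case)**: if
`checkUpperHerm n Cre Cim Δ ure uim μ` passes then every Hermitian `H` of the family has an
eigenvalue `≤ μ`. [folklore] -/
theorem exists_eigenvalues_le_of_checkUpperHerm {Cre Cim Δ : List (List ℚ)} {ure uim : List ℚ}
    {μ : ℚ} (h : checkUpperHerm n Cre Cim Δ ure uim μ = true) {H : Matrix (Fin n) (Fin n) ℂ}
    (hH : H.IsHermitian) (hΔ : ∀ i j : Fin n, ‖H i j - centreC Cre Cim i j‖ ≤ mreal Δ i j) :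
    ∃ i, hH.eigenvalues i ≤ μ := by
  set v : Fin n → ℂ := fun i ↦ testC ure uim i with hv
  have hpadV : ∀ i < n, padV v i = testC ure uim i := fun i hi ↦ by rw [padV_of_lt v hi]
  have hpadM : ∀ i ∈ range n, ∀ j ∈ range n, ‖padM H i j - centreC Cre Cim i j‖ ≤ mreal Δ i j := by
    intro i hi j hj
    rw [padM_of_lt H (mem_range.1 hi) (mem_range.1 hj)]
    exact hΔ _ _
  obtain ⟨h0, h1⟩ := re_hermForm_le_mul_normSq_of_checkUpperHerm h hpadM
  have hsq : ∑ i ∈ range n, ‖testC ure uim i‖ ^ 2 = ∑ i, ‖v i‖ ^ 2 := by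
    rw [← normSq_pad]
    exact Finset.sum_congr rfl fun i hi ↦ by rw [hpadV i (mem_range.1 hi)]
  have hform : ∑ i ∈ range n, ∑ j ∈ range n, star (testC ure uim i) * padM H i j * testC ure uim j =
      star v ⬝ᵥ (H *ᵥ v) := by
    rw [← hermForm_pad]
    refine Finset.sum_congr rfl fun i hi ↦ Finset.sum_congr rfl fun j hj ↦ ?_
    rw [hpadV i (mem_range.1 hi), hpadV j (mem_range.1 hj)]
  rw [hsq] at h0 h1
  rw [hform] at h1
  exact exists_eigenvalues_le_of_re_form_le hH h0 h1

/-! ### Parametric families over a box -/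

section Parametric

variable {β : Type}

/-- Leaf datum for a parametric REAL SYMMETRIC family over a box of parameters: entrywise enclosure
data `C ± Δ` valid on the leaf box, a lower certificate, and auxiliary data `aux` for the
user-supplied entry-enclosure check (e.g. working precisions). [folklore] -/
structure SymLeaf (β : Type) where
  /-- centre of the entries on the leaf box -/
  C : List (List ℚ)
  /-- radii of the entries on the leaf box -/
  Δ : List (List ℚ)
  /-- the lower certificate for the interval family `C ± Δ` -/
  cert : LDLCert
  /-- data for the entry-enclosure check -/
  aux : β

/-- Leaf datum for a parametric COMPLEX HERMITIAN family over a box of parameters. [folklore] -/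
structure HermLeaf (β : Type) where
  /-- real parts of the centre -/
  Cre : List (List ℚ)
  /-- imaginary parts of the centre -/
  Cim : List (List ℚ)
  /-- radii -/
  Δ : List (List ℚ)
  /-- the lower certificate for the embedded interval family -/
  cert : LDLCert
  /-- data for the entry-enclosure check -/
  aux : β

/-- Leaf check of a real symmetric family: the user's entry-enclosure check, the claimed uniform
bound `lam ≤ cert.lam`, and the lower checker. [folklore] -/
def symLeafOK (n : ℕ) (entryOK : Box → SymLeaf β → Bool) (lam : ℚ) (B : Box) (l : SymLeaf β) : Bool :=
  entryOK B l && decide (lam ≤ l.cert.lam) && checkLower n l.C l.Δ l.cert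

/-- Leaf check of a complex Hermitian family. [folklore] -/
def hermLeafOK (n : ℕ) (entryOK : Box → HermLeaf β → Bool) (lam : ℚ) (B : Box) (l : HermLeaf β) :
    Bool :=
  entryOK B l && decide (lam ≤ l.cert.lam) && checkLowerHerm n l.Cre l.Cim l.Δ l.cert

/-- **Uniform eigenvalue lower bound of a real symmetric family over a box.** Let `A k` be
symmetric for every parameter `k`, and let `entryOK B l = true` guarantee `|A k i j − C i j| ≤ Δ i j`
for all `k ∈ B`. If a kd-tree of leaves passes `KdCert.check (symLeafOK n entryOK lam)` on the box
`B`, then `lam ≤ λᵢ(A k)` for every `k ∈ B` and every `i`. [folklore] -/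
theorem le_eigenvalues_on_box_of_kdCheck_real {n : ℕ} {A : (ℕ → ℝ) → Matrix (Fin n) (Fin n) ℝ}
    (hA : ∀ k, (A k).IsHermitian) {entryOK : Box → SymLeaf β → Bool}
    (hentry : ∀ B l, entryOK B l = true → ∀ k, B.mem k →
      ∀ i j : Fin n, |A k i j - mreal l.C i j| ≤ mreal l.Δ i j)
    {lam : ℚ} {B : Box} {t : KdCert (SymLeaf β)} (h : t.check (symLeafOK n entryOK lam) B = true)
    (k : ℕ → ℝ) (hk : B.mem k) (i : Fin n) : (lam : ℝ) ≤ (hA k).eigenvalues i := by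
  refine KdCert.sound (P := fun k ↦ ∀ i, (lam : ℝ) ≤ (hA k).eigenvalues i) (fun B l hl k hk i ↦ ?_)
    t B h k hk i
  simp only [symLeafOK, Bool.and_eq_true, decide_eq_true_eq] at hl
  obtain ⟨⟨h1, h2⟩, h3⟩ := hl
  exact le_trans (by exact_mod_cast h2) (le_eigenvalues_of_checkLower h3 (hA k) (hentry B l h1 k hk) i)

/-- **Uniform eigenvalue lower bound of a complex Hermitian family over a box** (a certified
"Bloch scan"): with `entryOK B l = true` guaranteeing `‖H k i j − (Cre + i Cim) i j‖ ≤ Δ i j` on the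
leaf box, an accepted kd-tree proves `lam ≤ λᵢ(H k)` for every `k ∈ B`. [folklore] -/
theorem le_eigenvalues_on_box_of_kdCheck {n : ℕ} {H : (ℕ → ℝ) → Matrix (Fin n) (Fin n) ℂ}
    (hH : ∀ k, (H k).IsHermitian) {entryOK : Box → HermLeaf β → Bool}
    (hentry : ∀ B l, entryOK B l = true → ∀ k, B.mem k →
      ∀ i j : Fin n, ‖H k i j - centreC l.Cre l.Cim i j‖ ≤ mreal l.Δ i j)
    {lam : ℚ} {B : Box} {t : KdCert (HermLeaf β)} (h : t.check (hermLeafOK n entryOK lam) B = true)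
    (k : ℕ → ℝ) (hk : B.mem k) (i : Fin n) : (lam : ℝ) ≤ (hH k).eigenvalues i := by
  refine KdCert.sound (P := fun k ↦ ∀ i, (lam : ℝ) ≤ (hH k).eigenvalues i) (fun B l hl k hk i ↦ ?_)
    t B h k hk i
  simp only [hermLeafOK, Bool.and_eq_true, decide_eq_true_eq] at hl
  obtain ⟨⟨h1, h2⟩, h3⟩ := hl
  exact le_trans (by exact_mod_cast h2)
    (le_eigenvalues_of_checkLowerHerm h3 (hH k) (hentry B l h1 k hk) i)

/-- **Uniform form bound of a complex family over a box** (no Hermitian symmetry needed):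
`lam · Σ ‖v i‖² ≤ re (v* (H k) v)` for every `k ∈ B` and every `v`. [folklore] -/
theorem mul_normSq_le_re_on_box_of_kdCheck {n : ℕ} {H : (ℕ → ℝ) → Matrix (Fin n) (Fin n) ℂ}
    {entryOK : Box → HermLeaf β → Bool}
    (hentry : ∀ B l, entryOK B l = true → ∀ k, B.mem k →
      ∀ i j : Fin n, ‖H k i j - centreC l.Cre l.Cim i j‖ ≤ mreal l.Δ i j)
    {lam : ℚ} {B : Box} {t : KdCert (HermLeaf β)} (h : t.check (hermLeafOK n entryOK lam) B = true)
    (k : ℕ → ℝ) (hk : B.mem k) (v : Fin n → ℂ) :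
    (lam : ℝ) * ∑ i, ‖v i‖ ^ 2 ≤ RCLike.re (star v ⬝ᵥ (H k *ᵥ v)) := by
  refine KdCert.sound (P := fun k ↦ ∀ v : Fin n → ℂ,
      (lam : ℝ) * ∑ i, ‖v i‖ ^ 2 ≤ RCLike.re (star v ⬝ᵥ (H k *ᵥ v))) (fun B l hl k hk v ↦ ?_)
    t B h k hk v
  simp only [hermLeafOK, Bool.and_eq_true, decide_eq_true_eq] at hl
  obtain ⟨⟨h1, h2⟩, h3⟩ := hl
  refine le_trans ?_ (mul_normSq_le_re_of_checkLowerHerm h3 (hentry B l h1 k hk) v)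
  exact mul_le_mul_of_nonneg_right (by exact_mod_cast h2) (Finset.sum_nonneg fun i _ ↦ sq_nonneg _)

end Parametric

end Literature.Analysis.ValidatedNumerics

end
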